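import Summits.CriticalPhenomena.PercolationContinuityZ3.Theorems.Transplant.KNCells2ChainS
import HarnessLib

/-!
# The ROOTED band run under the DECOUPLED admissibility record `BandROK` (= `BandOK` minus `hρ0`): transverse half-width `ρ` and the
# backward along-extent `ρ₀ = 3q + s₁ + 2R'` of region `0` are INDEPENDENT — repair of FINDING F-DP4-2 (p5-g6 06:39:29Z; stmt-g9 06:18/06:40Z;
# design-owner ruling p3-g7 06:41:05Z); sibling of `KNCells2ChainBand` / `KNCells2ChainBandR` / `KNCells2ChainS` §2, no landed statement changes

builds on p205010 (kernel theorem, internal audit signed; external expert review pending) — nothing in this file uses p205010.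
Lane `prim-bschramm`, seat `prim-bschramm-p1` (gen 10; owner of the LEVEL-1 band files, defect desk); helper file
(`--supports stmt-CriticalPhenomena-4575 --as helper`).  Pure `Site 2` geometry.

THE DEFECT.  `ChainPlanar.Band.BandOK.hρ0 : 3q + s₁ + 2R' ≤ ρ` exists because the PLAIN region `0` is `sBox a σ c (−ρ) (q + s₁) ρ` — ONE `ρ`
serving as the backward along-extent AND as the transverse half-width of every region.  Every D″ consumer bounds `ρ` transversally by a
multiple of `r⊥ = A·e⊥` while `hρ0` asks `ρ ≥` an along-axis quantity in `e∥` units (long stride `s₁ = L·e∥ − R'`, or `q = e∥ − R'`), i.e. an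
AXIS-RATIO inequality `e∥ ≲ κ·e⊥` that the Step-I′ fact `TwoUnitL` does not provide (the two units are incomparable by design).  The ROOTED
regions `Band.regionR` (`KNCells2ChainAdvR`/`KNCells2ChainBandR`) already decouple the two lengths — region `0` is `sBox a σ c (−ρ₀) (q + s₁) ρ`
with `ρ₀ := Adv.ρ₀ q s₁ R' = 3q + s₁ + 2R'` built in — but `Band.scheduleR` was typed over the same `BandOK`, so the unprovable field survived.
THE REPAIR (this file, local): the record **`Band.BandROK`** with the six fields `hq hq' hs hs2 hρ hWM` (`hρ : q' + (N+1)R' + 2WM ≤ ρ` is the ONLY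
constraint on `ρ`), `BandOK.toROK`, and the rooted-run facts re-derived under it with statements VERBATIM those of the unprimed lemmas
(`BandOK ↦ BandROK`): **`core_routeR'`**, `enlarge_core_subset_regionR'`, `core_succ_subset_regionR'`, **`regionR_subset_prism'`** (prism
`sBox a σ c (−ρ₀) (q + (N+1)s₁) ρ`), `core_nonempty'`, and the schedule **`Band.scheduleR'`** with the same `rfl` API (`scheduleR'_core/_region/
_ax/_Wb/_params/_core_zero/_core_last`) plus `scheduleR'_eq_scheduleR` (on `BandOK` parameters the two schedules coincide, `rfl`).  Consumers ((F)
prefix + long band, (R) root run, (C) phase 3 of `Corr.schedule`) switch by renaming; their rooms then read: transverse `q' + (N+1)R' + 2WM ≤ ρ ≤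
c·r⊥`, along-axis back room `ρ₀ = 3q + s₁ + 2R'` behind the segment start — no inequality between `e∥` and `e⊥` anywhere.
[cite: KozmaNitzan2024, §4 Lemma 11 (pp. 22–23)]
-/

noncomputable section

namespace Summit.CriticalPhenomena.PercolationContinuityZ3.Theorems

namespace Transplant

namespace ChainPlanar

open Literature.Probability.Percolation Literature.Probability.LatticeModels
open Literature.Probability.Percolation.KozmaNitzan
open Literature.Probability.Percolation.KozmaNitzan.Cells (oth oth_ne eq_oth_of_ne)

namespace Band

/-! ## §1 The decoupled admissibility record -/

/-- **Admissible parameters of a ROOTED band run, decoupled form**: `BandOK` without the field `hρ0 : 3q + s₁ + 2R' ≤ ρ`; the transverse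
half-width `ρ` is constrained only by `hρ : q' + (N+1)R' + 2WM ≤ ρ` (the backward along-extent of region `0` is the separate constant
`Adv.ρ₀ q s₁ R' = 3q + s₁ + 2R'`). [cite: KozmaNitzan2024, §4 Lemma 11 (p. 22)] -/
structure BandROK (q q' s₁ ρ : ℤ) (R' ℓ₀ N WM : ℕ) (Wb : ℕ → ℕ) : Prop where
  hq : 0 ≤ q
  hq' : 0 ≤ q'
  hs : (R' : ℤ) + ℓ₀ ≤ s₁
  hs2 : 2 * (R' : ℤ) ≤ s₁
  hρ : q' + ((N : ℤ) + 1) * R' + 2 * WM ≤ ρ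
  hWM : ∀ ℓ : ℕ, (ℓ : ℤ) ≤ 2 * q + s₁ + R' → Wb ℓ ≤ WM

/-- Plain admissible parameters are decoupled-admissible (forget `hρ0`). [folklore] -/
theorem BandOK.toROK {q q' s₁ ρ : ℤ} {R' ℓ₀ N WM : ℕ} {Wb : ℕ → ℕ} (h : BandOK q q' s₁ ρ R' ℓ₀ N WM Wb) :
    BandROK q q' s₁ ρ R' ℓ₀ N WM Wb :=
  ⟨h.hq, h.hq', h.hs, h.hs2, h.hρ, h.hWM⟩

/-- Decoupled-admissible parameters are plainly admissible at the ENLARGED transverse width `max ρ ρ₀` (bookkeeping only; the rooted lemmas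
below keep the width `ρ`). [folklore] -/
theorem BandROK.toBandOK_max {q q' s₁ ρ : ℤ} {R' ℓ₀ N WM : ℕ} {Wb : ℕ → ℕ} (h : BandROK q q' s₁ ρ R' ℓ₀ N WM Wb) :
    BandOK q q' s₁ (max ρ (Adv.ρ₀ q s₁ R')) R' ℓ₀ N WM Wb :=
  ⟨h.hq, h.hq', h.hs, h.hs2, by rw [Adv.ρ₀]; exact le_max_right _ _, h.hρ.trans (le_max_left _ _), h.hWM⟩

/-! ## §2 The rooted band run under `BandROK` -/

variable {q q' s₁ ρ : ℤ} {R' N WM : ℕ} {ℓ₀ : ℕ} {Wb : ℕ → ℕ} {a : Fin 2} {σ : ℤ} (hσ : σ = 1 ∨ σ = -1) (c : Site 2)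
  (h : BandROK q q' s₁ ρ R' ℓ₀ N WM Wb)
include hσ h

/-- **BAND ROUTES of the rooted band run, decoupled parameters** (`k ≤ N`): for `v` in the `R'`-enlargement of `core k`, an extent
`ℓ ∈ [ℓ₀, 2q + s₁ + R']` with `ℓ = coreβ (k+1) − level(v)` such that the band rectangle lies in `regionR k` and a `τ`-half of its `σ`-side lies
in `core (k+1)` — statement verbatim `core_routeR` with `BandOK ↦ BandROK`. [cite: KozmaNitzan2024, §4 Lemma 11 (pp. 22–23)] -/
theorem core_routeR' {k : ℕ} (hk : k ≤ N) {v : Site 2}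
    (hv : v ∈ sBox a σ c (Adv.coreα q s₁ k - R') (Adv.coreβ q s₁ k + R') (coreW q' R' WM k + R')) :
    ∃ ℓ : ℕ, ℓ₀ ≤ ℓ ∧ (ℓ : ℤ) ≤ 2 * q + s₁ + R' ∧ (ℓ : ℤ) = Adv.coreβ q s₁ (k + 1) - σ * (v a - c a) ∧
      (∀ y : Site 2, |y a - v a| ≤ ℓ → |y (oth a) - v (oth a)| ≤ Wb ℓ → y ∈ regionR q s₁ ρ R' a σ c k) ∧
      ∃ τ : ℤ, (τ = 1 ∨ τ = -1) ∧ ∀ y : Site 2, y a - v a = σ * ℓ → 0 ≤ τ * (y (oth a) - v (oth a)) →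
        |y (oth a) - v (oth a)| ≤ Wb ℓ → y ∈ core q q' s₁ R' WM a σ c (k + 1) := by
  obtain ⟨⟨e0α, e0β, e0W⟩, eF⟩ := core_params (q := q) (q' := q') (s₁ := s₁) (R' := R') (WM := WM)
  have hq := h.hq; have hq' := h.hq'; have hs := h.hs; have hs2 := h.hs2; have hρ := h.hρ; have hWM := h.hWM
  have hR0 : (0 : ℤ) ≤ R' := by positivity
  have hW0 : (0 : ℤ) ≤ WM := by positivity
  have hNR : (0 : ℤ) ≤ (N : ℤ) * R' := by positivity
  by_cases hk0 : k = 0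
  · subst hk0
    obtain ⟨e1α, e1β, e1W⟩ := eF 1 le_rfl
    rw [e0α, e0β, e0W] at hv
    obtain ⟨ℓ, hℓ0, hℓhi, hℓ, hrect, τ, hτ, hhalf⟩ := route_band_startR hσ c (q := q) (q' := q') (s := s₁) (ρ := ρ) (R' := R')
      (ℓ₀ := ℓ₀) (WM := WM) Wb hs hWM (by nlinarith) hv
    refine ⟨ℓ, hℓ0, hℓhi, by rw [e1β]; push_cast; linarith, fun y h1 h2 => ?_, τ, hτ, fun y h1 h2 h3 => ?_⟩
    · rw [regionR, Adv.regionR, if_pos rfl]; exact hrect y h1 h2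
    · rw [core, e1α, e1β, e1W, w₁]
      have hy := hhalf y h1 h2 h3
      push_cast
      refine sBox_mono hσ c (by linarith) (by linarith) ?_ hy
      exact max_le (by linarith) (by linarith)
  · have hk1 : 1 ≤ k := by omega
    obtain ⟨eα, eβ, eW⟩ := eF k hk1
    obtain ⟨eα', eβ', eW'⟩ := eF (k + 1) (by omega)
    have hkR : ((k : ℤ) - 1) * R' ≤ ((N : ℤ) - 1) * R' :=
      mul_le_mul_of_nonneg_right (by linarith [(by exact_mod_cast hk : (k : ℤ) ≤ N)]) hR0
    have hkR0 : 0 ≤ ((k : ℤ) - 1) * R' := mul_nonneg (by linarith [(by exact_mod_cast hk1 : (1 : ℤ) ≤ k)]) hR0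
    rw [eα, eβ, eW] at hv
    have hWM' : ∀ ℓ : ℕ, (ℓ : ℤ) ≤ s₁ + R' → Wb ℓ ≤ WM := fun ℓ hℓ => hWM ℓ (by linarith)
    obtain ⟨ℓ, hℓ0, hℓhi, hℓ, hrect, τ, hτ, hhalf⟩ := route_band_advance hσ c (L := q + (k : ℤ) * s₁) (s := s₁)
      (w := w₁ q' R' WM + ((k : ℤ) - 1) * R') (ρ := ρ) (R' := R') (ℓ₀ := ℓ₀) (WM := WM) Wb hs hs2 hWM' (by unfold w₁; nlinarith) hv
    refine ⟨ℓ, hℓ0, by linarith, by rw [eβ']; push_cast; linarith, fun y h1 h2 => ?_, τ, hτ, fun y h1 h2 h3 => ?_⟩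
    · rw [regionR, Adv.regionR_of_ne_zero hk0, Adv.region, if_neg hk0]; exact hrect y h1 h2
    · rw [core, eα', eβ', eW']
      have hy := hhalf y h1 h2 h3
      push_cast
      refine sBox_mono hσ c (by linarith) (by linarith) ?_ hy
      exact max_le (by linarith) (by unfold w₁; linarith)

/-- **The `R'`-enlargement of core `k ≤ N` lies in the rooted region `k`**, decoupled parameters. [cite: KozmaNitzan2024, §4 Lemma 11 (p. 22)] -/
theorem enlarge_core_subset_regionR' {k : ℕ} (hk : k ≤ N) :
    sBox a σ c (Adv.coreα q s₁ k - R') (Adv.coreβ q s₁ k + R') (coreW q' R' WM k + R') ⊆ regionR q s₁ ρ R' a σ c k := by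
  obtain ⟨⟨e0α, e0β, e0W⟩, eF⟩ := core_params (q := q) (q' := q') (s₁ := s₁) (R' := R') (WM := WM)
  have hq := h.hq; have hq' := h.hq'; have hs := h.hs; have hs2 := h.hs2; have hρ := h.hρ
  have hR0 : (0 : ℤ) ≤ R' := by positivity
  have hW0 : (0 : ℤ) ≤ WM := by positivity
  have hNR : (0 : ℤ) ≤ (N : ℤ) * R' := by positivity
  by_cases hk0 : k = 0
  · subst hk0
    rw [e0α, e0β, e0W, regionR, Adv.regionR, if_pos rfl, Adv.ρ₀]
    exact sBox_mono hσ c (by linarith) (by linarith) (by linarith)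
  · have hk1 : 1 ≤ k := by omega
    obtain ⟨eα, eβ, eW⟩ := eF k hk1
    have hkR : ((k : ℤ) - 1) * R' ≤ ((N : ℤ) - 1) * R' :=
      mul_le_mul_of_nonneg_right (by linarith [(by exact_mod_cast hk : (k : ℤ) ≤ N)]) hR0
    rw [eα, eβ, eW, regionR, Adv.regionR_of_ne_zero hk0, Adv.region, if_neg hk0]
    exact sBox_mono hσ c (by linarith) (by linarith) (by unfold w₁; nlinarith)

/-- **The next core lies in the rooted region `k`** (`k ≤ N`), decoupled parameters. [cite: KozmaNitzan2024, §4 Lemma 11 (p. 22)] -/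
theorem core_succ_subset_regionR' {k : ℕ} (hk : k ≤ N) : core q q' s₁ R' WM a σ c (k + 1) ⊆ regionR q s₁ ρ R' a σ c k := by
  obtain ⟨-, eF⟩ := core_params (q := q) (q' := q') (s₁ := s₁) (R' := R') (WM := WM)
  have hq := h.hq; have hq' := h.hq'; have hs := h.hs; have hs2 := h.hs2; have hρ := h.hρ
  have hR0 : (0 : ℤ) ≤ R' := by positivity
  have hW0 : (0 : ℤ) ≤ WM := by positivity
  obtain ⟨eα, eβ, eW⟩ := eF (k + 1) (by omega)
  have hkR : (((k + 1 : ℕ) : ℤ) - 1) * R' ≤ (N : ℤ) * R' :=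
    mul_le_mul_of_nonneg_right (by push_cast; linarith [(by exact_mod_cast hk : (k : ℤ) ≤ N)]) hR0
  have hkR0 : 0 ≤ (((k + 1 : ℕ) : ℤ) - 1) * R' := mul_nonneg (by push_cast; linarith [(Nat.cast_nonneg k : (0 : ℤ) ≤ k)]) hR0
  rw [core, eα, eβ, eW]
  by_cases hk0 : k = 0
  · subst hk0
    rw [regionR, Adv.regionR, if_pos rfl, Adv.ρ₀]
    push_cast
    exact sBox_mono hσ c (by linarith) (by linarith) (by unfold w₁; linarith)
  · rw [regionR, Adv.regionR_of_ne_zero hk0, Adv.region, if_neg hk0]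
    push_cast
    exact sBox_mono hσ c (by nlinarith) (by linarith) (by unfold w₁; nlinarith)

/-- **All rooted regions lie in the prism** `{-(3q + s₁ + 2R') ≤ level ≤ q + (N+1) s₁, |trans| ≤ ρ}`, decoupled parameters (no relation
between `ρ` and `ρ₀`). [cite: KozmaNitzan2024, §4 Lemma 11 (p. 22: Ω)] -/
theorem regionR_subset_prism' {k : ℕ} (hk : k ≤ N) :
    regionR q s₁ ρ R' a σ c k ⊆ sBox a σ c (-(Adv.ρ₀ q s₁ R')) (q + ((N : ℤ) + 1) * s₁) ρ := by
  have hq := h.hq; have hs := h.hs; have hs2 := h.hs2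
  have hR0 : (0 : ℤ) ≤ R' := by positivity
  have hs0 : 0 ≤ s₁ := by linarith
  have hNs : (0 : ℤ) ≤ (N : ℤ) * s₁ := by positivity
  rw [regionR]
  by_cases hk0 : k = 0
  · subst hk0; rw [Adv.regionR, if_pos rfl]
    exact sBox_mono hσ c le_rfl (by nlinarith) le_rfl
  · have hk1 : 1 ≤ k := by omega
    rw [Adv.regionR, if_neg hk0, Adv.ρ₀]
    have hks : (k : ℤ) * s₁ ≤ (N : ℤ) * s₁ := mul_le_mul_of_nonneg_right (by exact_mod_cast hk) hs0
    have hks1 : s₁ ≤ (k : ℤ) * s₁ := by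
      have : (1 : ℤ) * s₁ ≤ (k : ℤ) * s₁ := mul_le_mul_of_nonneg_right (by exact_mod_cast hk1) hs0
      linarith
    exact sBox_mono hσ c (by linarith) (by linarith) le_rfl

/-- **All cores are nonempty**, decoupled parameters. [folklore] -/
theorem core_nonempty' (k : ℕ) : (core q q' s₁ R' WM a σ c k).Nonempty := by
  obtain ⟨⟨e0α, e0β, e0W⟩, eF⟩ := core_params (q := q) (q' := q') (s₁ := s₁) (R' := R') (WM := WM)
  have hq := h.hq; have hq' := h.hq'
  have hR0 : (0 : ℤ) ≤ R' := by positivity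
  have hW0 : (0 : ℤ) ≤ WM := by positivity
  rw [core]
  by_cases hk0 : k = 0
  · subst hk0; rw [e0α, e0β, e0W]; exact sBox_nonempty hσ c (by linarith) hq'
  · obtain ⟨eα, eβ, eW⟩ := eF k (by omega)
    have hkR0 : 0 ≤ ((k : ℤ) - 1) * R' := mul_nonneg (by linarith [(by exact_mod_cast (by omega : 1 ≤ k) : (1 : ℤ) ≤ k)]) hR0
    rw [eα, eβ, eW]; exact sBox_nonempty hσ c le_rfl (by unfold w₁; linarith)

/-! ## §3 The rooted band run as a schedule, decoupled parameters -/

variable (a) {ℓ₁ : ℕ} (hℓ₁ : 2 * q + s₁ + R' ≤ ℓ₁)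

/-- **The rooted band run as a schedule under `BandROK`** (cores `Band.core`, regions `Band.regionR`, constant axis `a` and sign `σ`, extents
`≤ ℓ₁` for any `ℓ₁ ≥ 2q + s₁ + R'`, prism `sBox a σ c (−ρ₀) (q + (N+1)s₁) ρ`). [cite: KozmaNitzan2024, §4 Lemma 11 (pp. 22–23)] -/
def scheduleR' : Schedule where
  ax := fun _ => a
  lo := fun k => sLo a σ c (Adv.coreα q s₁ k) (Adv.coreβ q s₁ k) (coreW q' R' WM k)
  hi := fun k => sHi a σ c (Adv.coreα q s₁ k) (Adv.coreβ q s₁ k) (coreW q' R' WM k)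
  region := regionR q s₁ ρ R' a σ c
  prism := sBox a σ c (-(Adv.ρ₀ q s₁ R')) (q + ((N : ℤ) + 1) * s₁) ρ
  N := N
  R' := R'
  ℓ₀ := ℓ₀
  ℓ₁ := ℓ₁
  Wb := fun _ => Wb
  encl k hk := by
    rw [sBox_enlarge a σ hσ]
    exact enlarge_core_subset_regionR' hσ c h hk
  succ k hk := core_succ_subset_regionR' hσ c h hk
  sub_prism k hk := regionR_subset_prism' hσ c h hk
  nonempty k _ := core_nonempty' hσ c h k
  route k hk v hv := by
    rw [sBox_enlarge a σ hσ] at hv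
    obtain ⟨ℓ, h0, h1, -, hrect, τ, hτ, hhalf⟩ := core_routeR' hσ c h hk hv
    have h1' : ℓ ≤ ℓ₁ := by
      have : (ℓ : ℤ) ≤ ℓ₁ := h1.trans hℓ₁
      exact_mod_cast this
    exact ⟨ℓ, h0, h1', σ, hσ, hrect, τ, hτ, hhalf⟩

/-- The cores of the decoupled rooted band schedule are the band cores. [folklore] -/
@[simp] theorem scheduleR'_core (k : ℕ) : (scheduleR' a hσ c h hℓ₁).core k = core q q' s₁ R' WM a σ c k := rfl

/-- The regions of the decoupled rooted band schedule are the rooted regions. [folklore] -/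
@[simp] theorem scheduleR'_region : (scheduleR' a hσ c h hℓ₁).region = regionR q s₁ ρ R' a σ c := rfl

/-- The axis of the decoupled rooted band schedule. [folklore] -/
@[simp] theorem scheduleR'_ax (k : ℕ) : (scheduleR' a hσ c h hℓ₁).ax k = a := rfl

/-- The band spread of the decoupled rooted band schedule. [folklore] -/
@[simp] theorem scheduleR'_Wb (k : ℕ) : (scheduleR' a hσ c h hℓ₁).Wb k = Wb := rfl

/-- The parameters of the decoupled rooted band schedule (`N`, `R'`, `ℓ₀`, `ℓ₁`, prism). [folklore] -/
theorem scheduleR'_params : (scheduleR' a hσ c h hℓ₁).N = N ∧ (scheduleR' a hσ c h hℓ₁).R' = R' ∧ (scheduleR' a hσ c h hℓ₁).ℓ₀ = ℓ₀ ∧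
    (scheduleR' a hσ c h hℓ₁).ℓ₁ = ℓ₁ ∧ (scheduleR' a hσ c h hℓ₁).prism = sBox a σ c (-(Adv.ρ₀ q s₁ R')) (q + ((N : ℤ) + 1) * s₁) ρ :=
  ⟨rfl, rfl, rfl, rfl, rfl⟩

/-- **The first core of the decoupled rooted band schedule is the start box** `{|level| ≤ q, |trans| ≤ q'}`. [folklore] -/
theorem scheduleR'_core_zero : (scheduleR' a hσ c h hℓ₁).core 0 = sBox a σ c (-q) q q' := by
  rw [scheduleR'_core]
  exact (core_zero_last (q := q) (q' := q') (s₁ := s₁) (R' := R') (N := N) (WM := WM) (a := a) (σ := σ) (c := c)).1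

/-- **The last core of the decoupled rooted band schedule is the far line core** `{level = q + (N+1) s₁, |trans| ≤ w₁ + N·R'}`. [folklore] -/
theorem scheduleR'_core_last : (scheduleR' a hσ c h hℓ₁).core (N + 1) =
    sBox a σ c (q + ((N : ℤ) + 1) * s₁) (q + ((N : ℤ) + 1) * s₁) (w₁ q' R' WM + (N : ℤ) * R') := by
  rw [scheduleR'_core]
  exact (core_zero_last (q := q) (q' := q') (s₁ := s₁) (R' := R') (N := N) (WM := WM) (a := a) (σ := σ) (c := c)).2

omit h in
/-- **On plainly admissible parameters the decoupled schedule IS the rooted schedule** (`rfl`: same data, proof fields irrelevant) — so every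
fact proved about `scheduleR` transfers. [folklore] -/
theorem scheduleR'_eq_scheduleR (hB : BandOK q q' s₁ ρ R' ℓ₀ N WM Wb) : scheduleR' a hσ c hB.toROK hℓ₁ = scheduleR a hσ c hB hℓ₁ := rfl

end Band

end ChainPlanar

end Transplant

end Summit.CriticalPhenomena.PercolationContinuityZ3.Theorems

end
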